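import Summits.CriticalPhenomena.SAWScalingLimit.Theses.SAWWeldingIdentification

/-!
# Route SAWWeldingIdentification — item `IdentifyFromWelding` (stmt-CriticalPhenomena-4507)

Measure-theoretic glue of the welding route: a probability measure `P` on curve classes and the
law `μ'.map Γ` of a random curve `Γ`, both carried (almost everywhere) by a set of curves on which
a measurable, countably-indexed family of real functionals (the welding at positive rationals)
separates points, and whose finite-dimensional welding marginals agree, are equal.

The proof is the classical Lusin–Souslin argument (Kechris, *Classical Descriptive Set Theory*,
Thm 15.1; Billingsley 1999 §1 for the π-system step): `CurveClass ℂ` is Polish with its Borel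
σ-algebra (`CurveClass.instPolishSpace`, `CurveClass.instBorelSpace`), so the welding vector
`V γ = (W Q γ q)_{q ∈ ℚ_{>0}}` maps Borel subsets of a full-measure Borel set of good curves
injectively onto Borel subsets of `ℚ_{>0} → ℝ` (`MeasurableSet.image_of_measurable_injOn`);
the laws of `V` under `P` and `μ'.map Γ` agree by uniqueness of projective limits
(`MeasureTheory.IsProjectiveLimit.unique`, cylinders form a π-system), whence `P A ≤ (μ'.map Γ) A`
for every Borel `A`, and two probability measures so related are equal.

Main result: `identifyFromWelding_proof : IdentifyFromWelding` (helpers in the sub-namespace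
`IdentifyFromWelding`).
-/

namespace Summit.CriticalPhenomena.SAWScalingLimit.Theorems

open MeasureTheory Set Function
open Literature.Probability.RandomPlanarGeometry

namespace IdentifyFromWelding

/-- Two probability measures `P`, `ν` with `P A ≤ ν A` for every measurable `A` are equal
(apply the inequality to `Aᶜ` and use `P Aᶜ = 1 - P A`). -/
theorem measure_eq_of_forall_measurableSet_le {α : Type*} [MeasurableSpace α]
    {P ν : Measure α} [IsProbabilityMeasure P] [IsProbabilityMeasure ν]
    (h : ∀ A, MeasurableSet A → P A ≤ ν A) : P = ν := by
  refine Measure.ext fun A hA => le_antisymm (h A hA) ?_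
  have h1 : ν A = 1 - ν Aᶜ := by
    rw [prob_compl_eq_one_sub hA, ENNReal.sub_sub_cancel ENNReal.one_ne_top prob_le_one]
  have h2 : P A = 1 - P Aᶜ := by
    rw [prob_compl_eq_one_sub hA, ENNReal.sub_sub_cancel ENNReal.one_ne_top prob_le_one]
  rw [h1, h2]
  exact tsub_le_tsub_left (h Aᶜ hA.compl) 1

/-- **Lusin–Souslin identification** (abstract form). Let `X` be standard Borel, `Y` countably
separated, `V : X → Y` measurable and injective on a set `G` (not assumed measurable). If a
probability measure `P` on `X` and the law `μ.map Γ` of an a.e.-measurable `Γ : Ω → X` under a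
probability measure `μ` are carried by `G` (`P`-a.e. `x ∈ G`, `μ`-a.e. `Γ ω ∈ G`) and have the
same image under `V`, then `P = μ.map Γ`. Proof: choose a measurable `T ⊆ G` with `P T = 1`;
for measurable `A`, `V '' (A ∩ T)` is measurable (Lusin–Souslin), so
`P A = P (A ∩ T) ≤ (P.map V) (V '' (A ∩ T)) = μ (Γ ⁻¹' V ⁻¹' V '' (A ∩ T)) ≤ μ (Γ ⁻¹' A) + 0`
by injectivity on `G`; conclude with `measure_eq_of_forall_measurableSet_le`. -/
theorem measure_eq_map_of_injOn_of_map_eq {X : Type*} [MeasurableSpace X] [StandardBorelSpace X]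
    {Y : Type*} [MeasurableSpace Y] [MeasurableSpace.CountablySeparated Y]
    {Ω : Type*} [MeasurableSpace Ω]
    {P : Measure X} [IsProbabilityMeasure P] {μ : Measure Ω} [IsProbabilityMeasure μ]
    {Γ : Ω → X} (hΓ : AEMeasurable Γ μ) {V : X → Y} (hV : Measurable V) (G : X → Prop)
    (hP : ∀ᵐ x ∂P, G x) (hμ : ∀ᵐ ω ∂μ, G (Γ ω))
    (hinj : ∀ x, G x → ∀ y, G y → V x = V y → x = y)
    (hlaw : P.map V = (μ.map Γ).map V) : P = μ.map Γ := by
  haveI : IsProbabilityMeasure (μ.map Γ) := Measure.isProbabilityMeasure_map hΓ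
  -- a measurable `P`-conull set `Nᶜ` of good points, and a `μ`-null measurable `N'` off which
  -- `Γ ω` is good
  obtain ⟨N, hNsub, hNmeas, hN0⟩ := exists_measurable_superset_of_null (ae_iff.1 hP)
  obtain ⟨N', hN'sub, -, hN'0⟩ := exists_measurable_superset_of_null (ae_iff.1 hμ)
  have hTG : ∀ x, x ∈ Nᶜ → G x := fun x hx => by_contra fun h => hx (hNsub h)
  refine measure_eq_of_forall_measurableSet_le fun A hA => ?_
  have hS : MeasurableSet (V '' (A ∩ Nᶜ)) :=
    (hA.inter hNmeas.compl).image_of_measurable_injOn hV fun x hx y hy hxy =>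
      hinj x (hTG x hx.2) y (hTG y hy.2) hxy
  have hsub : Γ ⁻¹' (V ⁻¹' (V '' (A ∩ Nᶜ))) ⊆ Γ ⁻¹' A ∪ N' := by
    intro ω hω
    by_cases hωN : ω ∈ N'
    · exact Or.inr hωN
    · obtain ⟨x, ⟨hxA, hxT⟩, hxV⟩ := hω
      have hG : G (Γ ω) := by_contra fun h => hωN (hN'sub h)
      have hx : x = Γ ω := hinj x (hTG x hxT) (Γ ω) hG hxV
      exact Or.inl (show Γ ω ∈ A from hx ▸ hxA)
  calc P A = P (A ∩ Nᶜ) := (measure_inter_conull (by rwa [compl_compl])).symm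
    _ ≤ P (V ⁻¹' (V '' (A ∩ Nᶜ))) := measure_mono (subset_preimage_image V _)
    _ = (μ.map Γ) (V ⁻¹' (V '' (A ∩ Nᶜ))) := by
        rw [← Measure.map_apply hV hS, hlaw, Measure.map_apply hV hS]
    _ = μ (Γ ⁻¹' (V ⁻¹' (V '' (A ∩ Nᶜ)))) := Measure.map_apply_of_aemeasurable hΓ (hV hS)
    _ ≤ μ (Γ ⁻¹' A ∪ N') := measure_mono hsub
    _ ≤ μ (Γ ⁻¹' A) + μ N' := measure_union_le _ _
    _ = (μ.map Γ) A := by rw [hN'0, add_zero, Measure.map_apply_of_aemeasurable hΓ hA]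

/-- **Finite-dimensional marginals determine the law of a countable family.** If two finite
measures `P`, `ν` on `X` give the same law to `(F (x i))_{i < k}` for every finite list
`x : Fin k → ι` of indices, then they give the same law to the whole family
`(F i)_{i ∈ ι}` in `ι → ℝ` (uniqueness of projective limits: measurable cylinders form a
π-system generating the product σ-algebra; Billingsley 1999, Thm 1.1 / Kolmogorov). -/
theorem map_pi_eq_of_forall_fin_marginals_eq {X : Type*} [MeasurableSpace X] {ι : Type*}
    {P ν : Measure X} [IsFiniteMeasure P] (F : ι → X → ℝ) (hF : ∀ i, Measurable (F i))
    (h : ∀ (k : ℕ) (x : Fin k → ι),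
      P.map (fun γ j => F (x j) γ) = ν.map (fun γ j => F (x j) γ)) :
    P.map (fun γ i => F i γ) = ν.map (fun γ i => F i γ) := by
  classical
  have hV : Measurable fun γ i => F i γ := measurable_pi_lambda _ fun i => hF i
  refine IsProjectiveLimit.unique
    (P := fun I : Finset ι => (P.map fun γ i => F i γ).map I.restrict) (fun I => rfl) fun I => ?_
  -- transfer the `Fin k`-indexed hypothesis to the finset `I`
  dsimp only
  obtain ⟨k, e⟩ : (k : ℕ) × (↥I ≃ Fin k) := ⟨_, Fintype.equivFin _⟩
  let x : Fin k → ι := fun j => ((e.symm j : ↥I) : ι)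
  have hG : Measurable fun γ (j : Fin k) => F (x j) γ := measurable_pi_lambda _ fun j => hF _
  have hH : Measurable fun (y : Fin k → ℝ) (i : ↥I) => y (e i) :=
    measurable_pi_lambda _ fun i => measurable_pi_apply _
  have hres : Measurable (I.restrict : (ι → ℝ) → (↥I → ℝ)) :=
    measurable_pi_lambda _ fun _ => measurable_pi_apply _
  have hcomp : (I.restrict : (ι → ℝ) → (↥I → ℝ)) ∘ (fun γ i => F i γ) =
      (fun (y : Fin k → ℝ) (i : ↥I) => y (e i)) ∘ fun γ j => F (x j) γ := by
    funext γ i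
    simp [x, Finset.restrict_def]
  rw [Measure.map_map hres hV, Measure.map_map hres hV, hcomp, ← Measure.map_map hH hG,
    ← Measure.map_map hH hG, h k x]

end IdentifyFromWelding

open IdentifyFromWelding in
/-- **Item `IdentifyFromWelding` (stmt-CriticalPhenomena-4507), proved.** Two probability
measures on `CurveClass ℂ` — a measure `P` and the law `μ'.map Γ` of an a.e.-measurable random
curve `Γ` — each carried almost everywhere by the conformally removable simple chords of the
Dobrushin domain `(Q.carrier; Q.pt 0, Q.pt 2)`, on which the measurable welding functional
`W Q · ·` separates points through its values at positive rationals, and whose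
finite-dimensional `W`-marginals at positive rational points coincide, are equal. This is the
Lusin–Souslin identification `measure_eq_map_of_injOn_of_map_eq` applied to the welding vector
`γ ↦ (W Q γ q)_{q ∈ ℚ_{>0}}` (measurable into the Polish space `ℚ_{>0} → ℝ`), the equality of
its laws coming from `map_pi_eq_of_forall_fin_marginals_eq`. -/
theorem identifyFromWelding_proof :
    Summit.CriticalPhenomena.SAWScalingLimit.Theses.SAWWeldingIdentification.IdentifyFromWelding := by
  intro Q W P Ω' _ μ' Γ hP hμ' hΓ hWmeas hPae hμae hinj hmarg
  haveI : IsProbabilityMeasure (μ'.map Γ) := Measure.isProbabilityMeasure_map hΓ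
  -- the welding vector at positive rationals
  let V : CurveClass ℂ → ({q : ℚ // 0 < q} → ℝ) := fun γ q => W Q γ ((q.1 : ℚ) : ℝ)
  have hV : Measurable V := measurable_pi_lambda _ fun q => hWmeas Q _
  refine measure_eq_map_of_injOn_of_map_eq hΓ hV _ hPae hμae ?_ ?_
  · -- the welding separates good curves through its positive-rational values
    intro γ hγ γ' hγ' hVeq
    exact hinj γ γ' hγ hγ' fun q hq => congr_fun hVeq ⟨q, hq⟩
  · -- the laws of the welding vector agree: finite-dimensional marginals + π-system
    refine map_pi_eq_of_forall_fin_marginals_eq (ν := μ'.map Γ)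
      (fun (q : {q : ℚ // 0 < q}) (γ : CurveClass ℂ) => W Q γ ((q.1 : ℚ) : ℝ))
      (fun q => hWmeas Q _) fun k x => ?_
    exact hmarg k (fun j => (x j).1) fun j => (x j).2

end Summit.CriticalPhenomena.SAWScalingLimit.Theorems
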